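import Mathlib

/-!
# AtomicCalibrationR (stmt-QuantumFields-28169), E2 `stub_offDiagonalWhitney` — Leibniz–multinomial bound with factorial (Gevrey) rates
# (roadmap v3 item G.2; prover w4 g22, free hands)

`WhitneyPkg` needs derivative bounds up to order `N'·n` with constants `α Cⁿ (n!)^γ`; the sups of the derivatives of a FIXED `C_c^∞`
profile grow factorially (Gevrey), so the honest per-factor hypothesis is `‖D^j f_i‖ ≤ (j!)^s · M^j`, not `M^j`.  This file upgrades
`ProductBump.norm_iteratedFDeriv_prod_le_pow` accordingly: the factorials of the orders distributed over the factors multiply to at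
most the factorial of the total order (`Nat.prod_factorial_dvd_factorial_sum`).

* `prod_factorial_count_le` — for `p ∈ u.sym m`: `∏_{j ∈ u} (count j p)! ≤ m!`;
* `norm_iteratedFDeriv_prod_le_factorial_pow` — `‖D^j f_i(x)‖ ≤ (j!)^s M^j` (`j ≤ m`, all `i ∈ u`) ⇒
  `‖D^m (∏_{i∈u} f_i)(x)‖ ≤ (m!)^s (#u · M)^m`.

Mathlib only; no stub/crux/rung/summit is closed; nothing here touches Yang–Mills; the YM mass gap is NOT proved. [folklore]
-/

set_option autoImplicit false

noncomputable section

open scoped BigOperators ContDiff Nat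

namespace Summit.QuantumFields.YangMills.Cruxes.AtomicCalibrationR.GevreyProduct

variable {E : Type} [NormedAddCommGroup E] [NormedSpace ℝ E]

/-- For `p ∈ u.sym m`, the factorials of the multiplicities multiply to at most `m!`. -/
theorem prod_factorial_count_le {ι : Type*} [DecidableEq ι] (u : Finset ι) (m : ℕ) {p : Sym ι m} (hp : p ∈ u.sym m) :
    ∏ j ∈ u, ((p : Multiset ι).count j)! ≤ m ! := by
  have hps : ∀ a ∈ (p : Multiset ι), a ∈ u := Finset.mem_sym_iff.1 hp
  have hsum : ∑ j ∈ u, (p : Multiset ι).count j = m := by rw [Multiset.sum_count_eq_card hps, Sym.card_coe]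
  have hdvd := Nat.prod_factorial_dvd_factorial_sum (s := u) (f := fun j => (p : Multiset ι).count j)
  rw [hsum] at hdvd
  exact Nat.le_of_dvd (Nat.factorial_pos m) hdvd

/-- **Leibniz–multinomial bound with factorial rates.**  If the factors of a finite product of real `C^∞` functions satisfy
`‖D^j f_i(x)‖ ≤ (j!)^s M^j` for `j ≤ m`, then `‖D^m (∏_{i ∈ u} f_i)(x)‖ ≤ (m!)^s (#u · M)^m`. [folklore] -/
theorem norm_iteratedFDeriv_prod_le_factorial_pow {ι : Type*} [DecidableEq ι] (u : Finset ι) (f : ι → E → ℝ)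
    (hf : ∀ i ∈ u, ContDiff ℝ ∞ (f i)) {M : ℝ} (hM : 0 ≤ M) (s m : ℕ) (x : E)
    (hb : ∀ i ∈ u, ∀ j : ℕ, j ≤ m → ‖iteratedFDeriv ℝ j (f i) x‖ ≤ ((j ! : ℕ) : ℝ) ^ s * M ^ j) :
    ‖iteratedFDeriv ℝ m (fun x => ∏ i ∈ u, f i x) x‖ ≤ ((m ! : ℕ) : ℝ) ^ s * ((u.card : ℝ) * M) ^ m := by
  have h1 := norm_iteratedFDeriv_prod_le (𝕜 := ℝ) (u := u) (f := f) (N := (⊤ : ℕ∞)) (x := x) (n := m)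
    (fun i hi => hf i hi) (by exact_mod_cast le_top)
  refine h1.trans ?_
  have hterm : ∀ p ∈ u.sym m, ((p : Multiset ι).countPerms : ℝ) *
      ∏ j ∈ u, ‖iteratedFDeriv ℝ ((p : Multiset ι).count j) (f j) x‖ ≤
        ((p : Multiset ι).countPerms : ℝ) * (((m ! : ℕ) : ℝ) ^ s * M ^ m) := by
    intro p hp
    refine mul_le_mul_of_nonneg_left ?_ (Nat.cast_nonneg _)
    have hps : ∀ a ∈ (p : Multiset ι), a ∈ u := Finset.mem_sym_iff.1 hp
    have hcount : ∀ j ∈ u, (p : Multiset ι).count j ≤ m := fun j _ =>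
      (Multiset.count_le_card j _).trans (le_of_eq (Sym.card_coe))
    calc ∏ j ∈ u, ‖iteratedFDeriv ℝ ((p : Multiset ι).count j) (f j) x‖
        ≤ ∏ j ∈ u, ((((p : Multiset ι).count j) ! : ℕ) : ℝ) ^ s * M ^ (p : Multiset ι).count j :=
          Finset.prod_le_prod (fun j _ => norm_nonneg _) fun j hj => hb j hj _ (hcount j hj)
      _ = ((∏ j ∈ u, (((p : Multiset ι).count j) ! : ℕ)) : ℝ) ^ s * M ^ ∑ j ∈ u, (p : Multiset ι).count j := by
          rw [Finset.prod_mul_distrib, Finset.prod_pow_eq_pow_sum, ← Finset.prod_pow]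
      _ ≤ ((m ! : ℕ) : ℝ) ^ s * M ^ m := by
          rw [Multiset.sum_count_eq_card hps, Sym.card_coe]
          refine mul_le_mul_of_nonneg_right ?_ (pow_nonneg hM _)
          exact pow_le_pow_left₀ (by positivity) (by exact_mod_cast prod_factorial_count_le u m hp) s
  calc ∑ p ∈ u.sym m, ((p : Multiset ι).countPerms : ℝ) * ∏ j ∈ u, ‖iteratedFDeriv ℝ ((p : Multiset ι).count j) (f j) x‖
      ≤ ∑ p ∈ u.sym m, ((p : Multiset ι).countPerms : ℝ) * (((m ! : ℕ) : ℝ) ^ s * M ^ m) := Finset.sum_le_sum hterm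
    _ = (u.card : ℝ) ^ m * (((m ! : ℕ) : ℝ) ^ s * M ^ m) := by
        rw [← Finset.sum_mul]
        congr 1
        have h := Finset.sum_pow (s := u) (fun _ : ι => (1 : ℝ)) m
        simp only [Finset.sum_const, nsmul_eq_mul, mul_one, Multiset.map_const', Multiset.prod_replicate, one_pow] at h
        exact h.symm
    _ = ((m ! : ℕ) : ℝ) ^ s * ((u.card : ℝ) * M) ^ m := by rw [mul_pow]; ring

end Summit.QuantumFields.YangMills.Cruxes.AtomicCalibrationR.GevreyProduct

end
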